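import Mathlib
import HarnessLib
import Summits.Langlands.Statement
import Summits.Langlands.Langlands.Theorems.LiftDescendAscentAutToGalGaloisTowerInduction
import Literature.NumberTheory.NumberFields.ConjugationSolvable

/-!
# `AscentResidual` from the four Galois-layer statements (glue of the line `registered`)

`--supports` file for the crux `BaseFieldAscent.AscentResidual` = `CMFern.AscentResidual` =
`SmithKummerSeed.AscentResidual` (stmt-Langlands-1095, shared): reciprocity for `GL_n` over every
conjugation-solvable number field implies reciprocity over every number field, where "reciprocity over
`F`" is the crux's matrix
`Rec F := ∃ R : ReciprocityData F, ∀ n > 0, ∀ hcpt, GlobalLanglandsCorrespondenceGLn n F R hcpt`.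

**What is proved (sorry-free).** The composition of the registered skeleton
`Cruxes/AscentResidual/Lines/birth.lean` (stubs `stub_cyclicPrimeAscent`, `stub_cyclicPrimeDescent`,
`stub_simpleAscent`, `stub_simpleDescent`), restated over the summit vocabulary ONLY — this module imports
no route file (`Theses/*.lean`), so that any route's deciding theorem may cite it without an import cycle
(cf. the `glue.cyclic-import` incident recorded on stmt-Langlands-17881):

* `numberField_induction_simpleLayers` — for an arbitrary property `P` of number fields: if `P` holds in
  absolute degree one, climbs and descends every Galois layer `L/K` of PRIME degree, and climbs and
  descends every Galois layer whose group `Gal(L/K)` is SIMPLE and NOT solvable, then `P` holds for every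
  number field. Proof: `ℚ ⊆ F ⊆ E` with `E` the Galois closure of `F/ℚ` (`exists_galois_sandwich`); climb
  `ℚ → E` and descend `E → F` by the landed tower induction
  `Theorems.AscentAutToGal.stub_galoisTowerInduction` / `galoisTowerDescent` (p148486: maximal proper
  normal subgroup ⇒ simple quotient ⇒ strong induction on the degree; a solvable simple group has prime
  order); the degenerate degrees `[E:F] = 1`, `[F:ℚ] = 1` are dispatched by transporting `IsGalois` along
  `F ≃ₐ[ℚ] E` and by the degree-one seed — `P` itself is never transported along a field isomorphism.
* `stub_ascentResidualOfLayers` — the instance `P := Rec`: the four layer statements, VERBATIM the bodies of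
  the route items `SmithKummerSeed.CyclicPrimeAscent` (stmt-Langlands-18649) and
  `SmithKummerSeed.CyclicPrimeDescent` (stmt-Langlands-18645) and of the registered stubs
  `stub_simpleAscent` / `stub_simpleDescent` of stmt-Langlands-1095, imply VERBATIM the body of
  `BaseFieldAscent.AscentResidual`; the seed is the crux's hypothesis (H) at the totally real fields of
  degree one (`IsConjugationSolvable.of_isTotallyReal`; `IsConjugationSolvable` is the crux's inline `∃`
  by `Iff.rfl`).

So, by name, `theorem AscentResidual_proof : BaseFieldAscent.AscentResidual :=
stub_ascentResidualOfLayers CyclicPrimeAscent_holds CyclicPrimeDescent_holds hSA hSD` the day the two cyclic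
items and the two simple-layer statements land (the latter are OPEN functoriality: insoluble automorphic
induction / base change / descent for `GL_n`, `Literature.Barriers.Langlands.SolvableImageBarrier`; they are
the crux's named content, handed back to the planners as crux-sized — lead notes PROMOTE.md on the item).

References: folklore Galois theory (normal closure; composition series, e.g. D. J. S. Robinson, *A course
in the theory of groups*, 5.4.8). No automorphic content beyond the summit's definitions.
-/

noncomputable section

-- `Summit.Langlands.Langlands.…` (summit = sub-problem name, D-0017 layout) trips `dupNamespace`
set_option linter.dupNamespace false

namespace Summit.Langlands.Langlands.Theorems.AscentResidual

open Summit.Langlands Summit.Langlands.Langlands.Theorems.AscentAutToGal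
open Literature.NumberTheory.Automorphic Literature.NumberTheory.NumberFields NumberField

/-! ## Every number field sits in a Galois number field -/

/-- **The Galois closure of a number field, as a sandwich `ℚ ⊆ F ⊆ E`.** For every number field `F`
there is a number field `E` (the normal closure of `F/ℚ` in an algebraic closure of `F`) with `F ⊆ E`,
`E/ℚ` Galois and (hence) `E/F` Galois. Mathlib: `IntermediateField.normalClosure`, `normalClosure.normal`,
`normalClosure.is_finiteDimensional`, `IsGalois.tower_top_of_isGalois`. [folklore] -/
theorem exists_galois_sandwich (F : Type) [Field F] [NumberField F] :
    ∃ (E : Type) (_ : Field E) (_ : NumberField E) (_ : Algebra F E) (_ : Algebra ℚ E),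
      IsGalois ℚ E ∧ IsGalois F E := by
  let Ω := AlgebraicClosure F
  haveI : Algebra.IsAlgebraic ℚ Ω := Algebra.IsAlgebraic.trans ℚ F Ω
  haveI : IsAlgClosure ℚ Ω := ⟨inferInstance, inferInstance⟩
  haveI : Normal ℚ Ω := IsAlgClosure.normal ℚ Ω
  let N : IntermediateField ℚ Ω := IntermediateField.normalClosure ℚ F Ω
  haveI : FiniteDimensional ℚ N := normalClosure.is_finiteDimensional ℚ F Ω
  haveI : Normal ℚ N := normalClosure.normal ℚ F Ω
  haveI : Algebra.IsSeparable ℚ N := Algebra.IsAlgebraic.isSeparable_of_perfectField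
  haveI hG : IsGalois ℚ N := IsGalois.mk
  haveI : NumberField N := NumberField.of_module_finite ℚ N
  haveI hGF : IsGalois F N := IsGalois.tower_top_of_isGalois ℚ F N
  exact ⟨N, inferInstance, inferInstance, inferInstance, inferInstance, hG, hGF⟩

/-! ## Induction over all number fields along simple Galois layers -/

/-- **Induction principle for number fields along simple Galois layers.** Let `P` be a property of
number fields which (i) holds for every number field of absolute degree one, (ii) climbs and (iii)
descends every Galois layer `L/K` of prime degree, and (iv) climbs and (v) descends every Galois layer
`L/K` whose Galois group `L ≃ₐ[K] L` is simple and not solvable (non-abelian simple). Then `P` holds for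
every number field: sandwich `ℚ ⊆ F ⊆ E` with `E/ℚ` and `E/F` Galois (`exists_galois_sandwich`); if
`[E:F] = 1` then `F ≃ₐ[ℚ] E` is Galois over `ℚ` and either `[F:ℚ] = 1` (seed) or `P` climbs `ℚ → F`
(`stub_galoisTowerInduction`, p148486); otherwise `1 < [E:F] ≤ [E:ℚ]`, `P` climbs `ℚ → E` and descends
`E → F` (`galoisTowerDescent`). `P` is never transported along a field isomorphism. [folklore] -/
theorem numberField_induction_simpleLayers (P : (K : Type) → [Field K] → [NumberField K] → Prop)
    (hone : ∀ (K : Type) [Field K] [NumberField K], Module.finrank ℚ K = 1 → P K)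
    (hCA : ∀ (K L : Type) [Field K] [NumberField K] [Field L] [NumberField L] [Algebra K L]
        [IsGalois K L], (Module.finrank K L).Prime → P K → P L)
    (hCD : ∀ (K L : Type) [Field K] [NumberField K] [Field L] [NumberField L] [Algebra K L]
        [IsGalois K L], (Module.finrank K L).Prime → P L → P K)
    (hSA : ∀ (K L : Type) [Field K] [NumberField K] [Field L] [NumberField L] [Algebra K L]
        [IsGalois K L], IsSimpleGroup (L ≃ₐ[K] L) → ¬ IsSolvable (L ≃ₐ[K] L) → P K → P L)
    (hSD : ∀ (K L : Type) [Field K] [NumberField K] [Field L] [NumberField L] [Algebra K L]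
        [IsGalois K L], IsSimpleGroup (L ≃ₐ[K] L) → ¬ IsSolvable (L ≃ₐ[K] L) → P L → P K) :
    ∀ (F : Type) [Field F] [NumberField F], P F := by
  intro F _ _
  -- the seed at `ℚ`
  have hQ : P ℚ := hone ℚ (Module.finrank_self ℚ)
  obtain ⟨E, _, _, _, _, hGal, hGalF⟩ := exists_galois_sandwich F
  haveI := hGal
  haveI := hGalF
  haveI : IsScalarTower ℚ F E := IsScalarTower.of_algebraMap_eq' (Subsingleton.elim _ _)
  haveI : FiniteDimensional ℚ E := Module.Finite.of_restrictScalars_finite ℚ ℚ E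
  haveI : FiniteDimensional F E := Module.Finite.of_restrictScalars_finite ℚ F E
  by_cases hFE : Module.finrank F E = 1
  · -- degenerate top: `F ≃ E` over `ℚ`, so `F/ℚ` is itself Galois
    have hbij : Function.Bijective (algebraMap F E) :=
      (Algebra.finrank_eq_one_iff_bijective_algebraMap).mp hFE
    let e : F ≃ₐ[ℚ] E := AlgEquiv.ofBijective (IsScalarTower.toAlgHom ℚ F E) hbij
    haveI : IsGalois ℚ F := IsGalois.of_algEquiv e.symm
    by_cases hQF : Module.finrank ℚ F = 1
    · -- doubly degenerate: the degree-one seed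
      exact hone F hQF
    · exact stub_galoisTowerInduction P hCA hSA ℚ F
        (lt_of_le_of_ne (Nat.succ_le_of_lt Module.finrank_pos) (Ne.symm hQF)) hQ
  · have hltFE : 1 < Module.finrank F E :=
      lt_of_le_of_ne (Nat.succ_le_of_lt Module.finrank_pos) (Ne.symm hFE)
    have hltE : 1 < Module.finrank ℚ E :=
      calc 1 < Module.finrank F E := hltFE
        _ ≤ Module.finrank ℚ F * Module.finrank F E := Nat.le_mul_of_pos_left _ Module.finrank_pos
        _ = Module.finrank ℚ E := Module.finrank_mul_finrank ℚ F E
    exact galoisTowerDescent P hCD hSD F E hltFE (stub_galoisTowerInduction P hCA hSA ℚ E hltE hQ)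

/-- A number field of absolute degree one is totally real (it is `ℚ`, along the bijective
`algebraMap ℚ K`). [folklore] -/
theorem isTotallyReal_of_finrank_eq_one (K : Type) [Field K] [NumberField K]
    (h : Module.finrank ℚ K = 1) : IsTotallyReal K :=
  IsTotallyReal.ofRingEquiv
    (RingEquiv.ofBijective (algebraMap ℚ K) ((Algebra.finrank_eq_one_iff_bijective_algebraMap).mp h))

/-! ## The crux from the four layer statements -/

/-- **`AscentResidual` from the four Galois-layer statements** (glue of the registered line of
stmt-Langlands-1095). Hypotheses, verbatim: `hCA` = the body of `SmithKummerSeed.CyclicPrimeAscent`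
(stmt-Langlands-18649: reciprocity for `GL` ascends a Galois layer of prime degree), `hCD` = the body of
`SmithKummerSeed.CyclicPrimeDescent` (stmt-Langlands-18645: it descends such a layer), `hSA` / `hSD` = the
registered stubs `stub_simpleAscent` / `stub_simpleDescent` (reciprocity ascends / descends a Galois layer
with non-abelian simple group — OPEN functoriality, `Literature.Barriers.Langlands.SolvableImageBarrier`).
Conclusion, verbatim: the body of `BaseFieldAscent.AscentResidual` (= `CMFern.AscentResidual` =
`SmithKummerSeed.AscentResidual`): reciprocity over every conjugation-solvable field implies reciprocity over
every number field. Proof: `numberField_induction_simpleLayers` at `P := Rec`, seeded by the hypothesis (H)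
at the degree-one fields, which are totally real (`isTotallyReal_of_finrank_eq_one`) hence
conjugation-solvable (`IsConjugationSolvable.of_isTotallyReal`, the crux's inline `∃` by `Iff.rfl`); (H) is
consumed nowhere else. [folklore] -/
theorem stub_ascentResidualOfLayers :
    (∀ (K L : Type) [Field K] [NumberField K] [Field L] [NumberField L] [Algebra K L] [IsGalois K L],
      (Module.finrank K L).Prime →
        (∃ R : ReciprocityData K, ∀ n : ℕ, 0 < n →
          ∀ hcpt : Literature.NumberTheory.Automorphic.isCompact_glFiniteIntegralLevel n K,
            GlobalLanglandsCorrespondenceGLn n K R hcpt) →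
        ∃ R : ReciprocityData L, ∀ n : ℕ, 0 < n →
          ∀ hcpt : Literature.NumberTheory.Automorphic.isCompact_glFiniteIntegralLevel n L,
            GlobalLanglandsCorrespondenceGLn n L R hcpt) →
    (∀ (K L : Type) [Field K] [NumberField K] [Field L] [NumberField L] [Algebra K L] [IsGalois K L],
      (Module.finrank K L).Prime →
        (∃ R : ReciprocityData L, ∀ n : ℕ, 0 < n →
          ∀ hcpt : Literature.NumberTheory.Automorphic.isCompact_glFiniteIntegralLevel n L,
            GlobalLanglandsCorrespondenceGLn n L R hcpt) →
        ∃ R : ReciprocityData K, ∀ n : ℕ, 0 < n →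
          ∀ hcpt : Literature.NumberTheory.Automorphic.isCompact_glFiniteIntegralLevel n K,
            GlobalLanglandsCorrespondenceGLn n K R hcpt) →
    (∀ (K L : Type) [Field K] [NumberField K] [Field L] [NumberField L] [Algebra K L] [IsGalois K L],
      IsSimpleGroup (L ≃ₐ[K] L) → ¬ IsSolvable (L ≃ₐ[K] L) →
        (∃ R : ReciprocityData K, ∀ n : ℕ, 0 < n →
          ∀ hcpt : Literature.NumberTheory.Automorphic.isCompact_glFiniteIntegralLevel n K,
            GlobalLanglandsCorrespondenceGLn n K R hcpt) →
        ∃ R : ReciprocityData L, ∀ n : ℕ, 0 < n →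
          ∀ hcpt : Literature.NumberTheory.Automorphic.isCompact_glFiniteIntegralLevel n L,
            GlobalLanglandsCorrespondenceGLn n L R hcpt) →
    (∀ (K L : Type) [Field K] [NumberField K] [Field L] [NumberField L] [Algebra K L] [IsGalois K L],
      IsSimpleGroup (L ≃ₐ[K] L) → ¬ IsSolvable (L ≃ₐ[K] L) →
        (∃ R : ReciprocityData L, ∀ n : ℕ, 0 < n →
          ∀ hcpt : Literature.NumberTheory.Automorphic.isCompact_glFiniteIntegralLevel n L,
            GlobalLanglandsCorrespondenceGLn n L R hcpt) →
        ∃ R : ReciprocityData K, ∀ n : ℕ, 0 < n →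
          ∀ hcpt : Literature.NumberTheory.Automorphic.isCompact_glFiniteIntegralLevel n K,
            GlobalLanglandsCorrespondenceGLn n K R hcpt) →
    (∀ (F : Type) [Field F] [NumberField F],
      (∃ (F₀ E : Type) (_ : Field F₀) (_ : NumberField F₀) (_ : Field E) (_ : NumberField E)
        (_ : Algebra F₀ F) (_ : Algebra F E) (_ : Algebra F₀ E) (_ : IsScalarTower F₀ F E)
        (_ : IsGalois F₀ E), NumberField.IsTotallyReal F₀ ∧ IsSolvable (E ≃ₐ[F₀] E)) →
      ∃ R : ReciprocityData F, ∀ n : ℕ, 0 < n →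
        ∀ hcpt : Literature.NumberTheory.Automorphic.isCompact_glFiniteIntegralLevel n F,
          GlobalLanglandsCorrespondenceGLn n F R hcpt) →
    ∀ (F : Type) [Field F] [NumberField F], ∃ R : ReciprocityData F, ∀ n : ℕ, 0 < n →
      ∀ hcpt : Literature.NumberTheory.Automorphic.isCompact_glFiniteIntegralLevel n F,
        GlobalLanglandsCorrespondenceGLn n F R hcpt := by
  intro hCA hCD hSA hSD H
  refine numberField_induction_simpleLayers
    (fun K _ _ => ∃ R : ReciprocityData K, ∀ n : ℕ, 0 < n →
      ∀ hcpt : Literature.NumberTheory.Automorphic.isCompact_glFiniteIntegralLevel n K,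
        GlobalLanglandsCorrespondenceGLn n K R hcpt)
    (fun K _ _ hK => ?_) hCA hCD hSA hSD
  -- the seed: a degree-one field is totally real, hence conjugation-solvable, and (H) applies
  haveI : IsTotallyReal K := isTotallyReal_of_finrank_eq_one K hK
  exact H K IsConjugationSolvable.of_isTotallyReal

end Summit.Langlands.Langlands.Theorems.AscentResidual

end
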